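import Summits.ValiantsHypothesis.ValiantsHypothesis.Theorems.LacunarySymmetroidMatrixDescartesDoorA26WallBubblingOrderThreeDichotomy

/-!
# `DoorA26` / line `wall_bubbling` — THE SECOND-ORDER DICHOTOMY FOR PROFILES OF ORDER ≤ 3 (level 2 of the obstruction tower)

HONEST FRAMING.  Object-search cell `pub-symmetroid`, crux `Theses.LacunarySymmetroid.DoorA26` (stmt-ValiantsHypothesis-19979; OPEN, typed,
never asserted).  W2 seat val-sym-door-p1 g20, file #87; def-free helper for obligation (R) of `Cruxes/DoorA26/Lines/wall_bubbling.lean`.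
Imports #81 `…OrderThreeDichotomy` (linearity of the jets of the first variation; Rockafellar 21.1 from the tree's Literature).

WHY.  Memo `DOOR-A26-P1G20-NEWTON-LIFT.md` §3: when the first-order system is obstructed, a lift needs a first shift `T₁` whose first variation
`c₁ = pol(P,Q₁)` PERSISTS (`c₁(z_j) = 0` at every multiple zero, `c₁′ = 0` at the triple zeros) and a second shift `T₂` such that, with
`c₂ = pol(P,Q₂) + det Q₁`: every touch has positive discriminant `c₁′(z_j)² − 4A_j c₂(z_j) > 0` (`A_j = F″(z_j)/2`), and every triple zero has
`c₂(z_j) = 0` and `B² > 3A e₁` (`A = F‴/6`, `B = c₁″/2`, `e₁ = c₂′`) — then #82 opens everything (witnesses exist; memo §3.3).  These conditions are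
AFFINE in `T₂` (the constants `det Q₁(z_j) ≤ 0`, `(det Q₁)′` are what the memo's `Φ` balances against the first-order relation), so Rockafellar's
alternative on the affine subspace `{c₂ = 0 at the triple zeros}` gives the LEVEL-2 DICHOTOMY below: such a `T₂` exists, or a certificate
(multipliers `λ ≥ 0`, not all zero, with `Σ λ_j f_j ≥ 0` on that subspace, `f_j` the affine defect functionals).  With the unique first-order relation of
the |J| = 7 core the certificate is exactly `Φ(Q₁) ≤ 0` (memo §3.3).

WHAT IS HERE.  ★★ `secondOrder_feasible_or_certificate_orderThree` (coordinate letters `!![w l 0, w l 1; w l 1, w l 2]` for `T₂`; the slope at a triple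
zero is written `(pol(P,Q₂))′(z) + (det Q₁)′(z)`).  Nothing here bears on `DoorA26`, `DoorA34`, (W)/(M)/(R), `MatrixDescartes` (18050) or `VP ≠ VNP`;
registers unchanged.

[cite: Rockafellar1970, §21 Thm 21.1] (tree).  [this work] the dichotomy.
-/

set_option linter.dupNamespace false

namespace Summit.ValiantsHypothesis.ValiantsHypothesis.Theorems.LacunarySymmetroidMatrixDescartes.WallBubbling

open Finset Filter Topology
open Bubbling (TwentyLocus expSum)

/-- ★★ **LEVEL-2 DICHOTOMY FOR PROFILES OF ORDER ≤ 3.**  Data: symmetric `S`, a first shift `T₁`, separated points `z_j` with labels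
`m_j ∈ {1,2,3}`, `Σ m_j ≥ 20` (only `r ≥ 1` is used).  With `F = det P`, `c₁ = pol(P,Q₁)`, `d₁ = det Q₁` and, for a coordinate shift `w`,
`π_w = pol(P, Q_w)`: EITHER some `w` has `π_w(z_j) + d₁(z_j) = 0` at every triple zero, `4·(F″(z_j)/2)·(π_w(z_j) + d₁(z_j)) < c₁′(z_j)²` at every
touch and `3·(F‴(z_j)/6)·(π_w′(z_j) + d₁′(z_j)) < (c₁″(z_j)/2)²` at every triple zero; OR there are `λ_j ≥ 0`, not all zero, with
`Σ_j λ_j f_j(w) ≥ 0` for every `w` satisfying the triple-zero equalities, where `f_j(w)` is the affine defect (`−1` at simple zeros). [this work] -/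
theorem secondOrder_feasible_or_certificate_orderThree (δ : Fin 6 → ℝ) (S T₁ : Fin 6 → Matrix (Fin 2) (Fin 2) ℝ)
    {r : ℕ} (z : Fin r → ℝ) (m : Fin r → ℕ) (hm : 20 ≤ ∑ j, m j) :
    (∃ w : Fin 6 → Fin 3 → ℝ,
      (∀ j, m j = 3 →
        (((∑ l, Real.exp (δ l * z j) • S l) + (∑ l, Real.exp (δ l * z j) • (!![w l 0, w l 1; w l 1, w l 2] : Matrix (Fin 2) (Fin 2) ℝ))).det
          - (∑ l, Real.exp (δ l * z j) • S l).det
          - (∑ l, Real.exp (δ l * z j) • (!![w l 0, w l 1; w l 1, w l 2] : Matrix (Fin 2) (Fin 2) ℝ)).det)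
          + (∑ l, Real.exp (δ l * z j) • T₁ l).det = 0) ∧
      (∀ j, m j = 2 →
        4 * (iteratedDeriv 2 (fun t => (∑ l, Real.exp (δ l * t) • S l).det) (z j) / 2) *
          ((((∑ l, Real.exp (δ l * z j) • S l) + (∑ l, Real.exp (δ l * z j) • (!![w l 0, w l 1; w l 1, w l 2] : Matrix (Fin 2) (Fin 2) ℝ))).det
            - (∑ l, Real.exp (δ l * z j) • S l).det
            - (∑ l, Real.exp (δ l * z j) • (!![w l 0, w l 1; w l 1, w l 2] : Matrix (Fin 2) (Fin 2) ℝ)).det)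
            + (∑ l, Real.exp (δ l * z j) • T₁ l).det)
        < (deriv (fun t => ((∑ l, Real.exp (δ l * t) • S l) + (∑ l, Real.exp (δ l * t) • T₁ l)).det
            - (∑ l, Real.exp (δ l * t) • S l).det - (∑ l, Real.exp (δ l * t) • T₁ l).det) (z j)) ^ 2) ∧
      (∀ j, m j = 3 →
        3 * (iteratedDeriv 3 (fun t => (∑ l, Real.exp (δ l * t) • S l).det) (z j) / 6) *
          (deriv (fun t => ((∑ l, Real.exp (δ l * t) • S l) + (∑ l, Real.exp (δ l * t) • (!![w l 0, w l 1; w l 1, w l 2] : Matrix (Fin 2) (Fin 2) ℝ))).det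
              - (∑ l, Real.exp (δ l * t) • S l).det
              - (∑ l, Real.exp (δ l * t) • (!![w l 0, w l 1; w l 1, w l 2] : Matrix (Fin 2) (Fin 2) ℝ)).det) (z j)
            + deriv (fun t => (∑ l, Real.exp (δ l * t) • T₁ l).det) (z j))
        < (iteratedDeriv 2 (fun t => ((∑ l, Real.exp (δ l * t) • S l) + (∑ l, Real.exp (δ l * t) • T₁ l)).det
            - (∑ l, Real.exp (δ l * t) • S l).det - (∑ l, Real.exp (δ l * t) • T₁ l).det) (z j) / 2) ^ 2)) ∨
    (∃ lam : Fin r → ℝ, (∀ j, 0 ≤ lam j) ∧ lam ≠ 0 ∧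
      ∀ w : Fin 6 → Fin 3 → ℝ,
        (∀ j, m j = 3 →
          (((∑ l, Real.exp (δ l * z j) • S l) + (∑ l, Real.exp (δ l * z j) • (!![w l 0, w l 1; w l 1, w l 2] : Matrix (Fin 2) (Fin 2) ℝ))).det
            - (∑ l, Real.exp (δ l * z j) • S l).det
            - (∑ l, Real.exp (δ l * z j) • (!![w l 0, w l 1; w l 1, w l 2] : Matrix (Fin 2) (Fin 2) ℝ)).det)
            + (∑ l, Real.exp (δ l * z j) • T₁ l).det = 0) →
        0 ≤ ∑ j, lam j *
          (if m j = 2 then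
            4 * (iteratedDeriv 2 (fun t => (∑ l, Real.exp (δ l * t) • S l).det) (z j) / 2) *
              ((((∑ l, Real.exp (δ l * z j) • S l) + (∑ l, Real.exp (δ l * z j) • (!![w l 0, w l 1; w l 1, w l 2] : Matrix (Fin 2) (Fin 2) ℝ))).det
                - (∑ l, Real.exp (δ l * z j) • S l).det
                - (∑ l, Real.exp (δ l * z j) • (!![w l 0, w l 1; w l 1, w l 2] : Matrix (Fin 2) (Fin 2) ℝ)).det)
                + (∑ l, Real.exp (δ l * z j) • T₁ l).det)
            - (deriv (fun t => ((∑ l, Real.exp (δ l * t) • S l) + (∑ l, Real.exp (δ l * t) • T₁ l)).det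
                - (∑ l, Real.exp (δ l * t) • S l).det - (∑ l, Real.exp (δ l * t) • T₁ l).det) (z j)) ^ 2
           else if m j = 3 then
            3 * (iteratedDeriv 3 (fun t => (∑ l, Real.exp (δ l * t) • S l).det) (z j) / 6) *
              (deriv (fun t => ((∑ l, Real.exp (δ l * t) • S l) + (∑ l, Real.exp (δ l * t) • (!![w l 0, w l 1; w l 1, w l 2] : Matrix (Fin 2) (Fin 2) ℝ))).det
                  - (∑ l, Real.exp (δ l * t) • S l).det
                  - (∑ l, Real.exp (δ l * t) • (!![w l 0, w l 1; w l 1, w l 2] : Matrix (Fin 2) (Fin 2) ℝ)).det) (z j)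
                + deriv (fun t => (∑ l, Real.exp (δ l * t) • T₁ l).det) (z j))
            - (iteratedDeriv 2 (fun t => ((∑ l, Real.exp (δ l * t) • S l) + (∑ l, Real.exp (δ l * t) • T₁ l)).det
                - (∑ l, Real.exp (δ l * t) • S l).det - (∑ l, Real.exp (δ l * t) • T₁ l).det) (z j) / 2) ^ 2
           else -1)) := by
  classical
  -- fixed data
  set F : ℝ → ℝ := fun t => (∑ l, Real.exp (δ l * t) • S l).det with hF
  set c₁ : ℝ → ℝ := fun t => ((∑ l, Real.exp (δ l * t) • S l) + (∑ l, Real.exp (δ l * t) • T₁ l)).det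
      - (∑ l, Real.exp (δ l * t) • S l).det - (∑ l, Real.exp (δ l * t) • T₁ l).det with hc₁
  set d₁ : ℝ → ℝ := fun t => (∑ l, Real.exp (δ l * t) • T₁ l).det with hd₁
  -- the first variation of a coordinate shift
  let π : (Fin 6 → Fin 3 → ℝ) → ℝ → ℝ := fun w t => ((∑ l, Real.exp (δ l * t) • S l)
      + (∑ l, Real.exp (δ l * t) • (!![w l 0, w l 1; w l 1, w l 2] : Matrix (Fin 2) (Fin 2) ℝ))).det
    - (∑ l, Real.exp (δ l * t) • S l).det
    - (∑ l, Real.exp (δ l * t) • (!![w l 0, w l 1; w l 1, w l 2] : Matrix (Fin 2) (Fin 2) ℝ)).det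
  have hL : ∀ (a b : ℝ) (w w' : Fin 6 → Fin 3 → ℝ) (n : ℕ) (t : ℝ),
      iteratedDeriv n (π (a • w + b • w')) t = a * iteratedDeriv n (π w) t + b * iteratedDeriv n (π w') t :=
    fun a b w w' n t => iteratedDeriv_firstVariation_linear δ S a b w w' n t
  have hL0 : ∀ (a b : ℝ) (w w' : Fin 6 → Fin 3 → ℝ) (t : ℝ), π (a • w + b • w') t = a * π w t + b * π w' t := by
    intro a b w w' t
    simpa only [iteratedDeriv_zero] using hL a b w w' 0 t
  have hL1 : ∀ (a b : ℝ) (w w' : Fin 6 → Fin 3 → ℝ) (t : ℝ), deriv (π (a • w + b • w')) t = a * deriv (π w) t + b * deriv (π w') t := by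
    intro a b w w' t
    simpa only [iteratedDeriv_one] using hL a b w w' 1 t
  -- the affine data
  let X := Fin 6 → Fin 3 → ℝ
  let C : Set X := {w | ∀ j, m j = 3 → π w (z j) + d₁ (z j) = 0}
  let f : Fin r → X → ℝ := fun j w =>
    if m j = 2 then 4 * (iteratedDeriv 2 F (z j) / 2) * (π w (z j) + d₁ (z j)) - (deriv c₁ (z j)) ^ 2
    else if m j = 3 then 3 * (iteratedDeriv 3 F (z j) / 6) * (deriv (π w) (z j) + deriv d₁ (z j)) - (iteratedDeriv 2 c₁ (z j) / 2) ^ 2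
    else -1
  have hC : Convex ℝ C := by
    intro x hx y hy a b _ _ hab j hj
    show π (a • x + b • y) (z j) + d₁ (z j) = 0
    have hx' : π x (z j) + d₁ (z j) = 0 := hx j hj
    have hy' : π y (z j) + d₁ (z j) = 0 := hy j hj
    rw [hL0]
    calc a * π x (z j) + b * π y (z j) + d₁ (z j) = a * (π x (z j) + d₁ (z j)) + b * (π y (z j) + d₁ (z j)) + (1 - (a + b)) * d₁ (z j) := by ring
      _ = 0 := by rw [hx', hy', hab]; ring
  have hf : ∀ j, ConvexOn ℝ C (f j) := by
    intro j
    refine ⟨hC, fun x _ y _ a b _ _ hab => le_of_eq ?_⟩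
    by_cases h2 : m j = 2
    · simp only [f, h2, if_true, smul_eq_mul]
      rw [hL0]
      have : b = 1 - a := by linarith
      subst this; ring
    · by_cases h3 : m j = 3
      · simp only [f, h3, show (3 : ℕ) ≠ 2 by norm_num, if_false, if_true, smul_eq_mul]
        rw [hL1]
        have : b = 1 - a := by linarith
        subst this; ring
      · simp only [f, h2, h3, if_false, smul_eq_mul]
        have : b = 1 - a := by linarith
        subst this; ring
  have hr : 0 < r := by
    rcases Nat.eq_zero_or_pos r with h | h
    · subst h; simp at hm
    · exact h
  haveI : Nonempty (Fin r) := ⟨⟨0, hr⟩⟩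
  by_cases hfeas : ∃ w ∈ C, ∀ j, f j w < 0
  · obtain ⟨w, hwC, hw⟩ := hfeas
    left
    refine ⟨w, fun j hj => hwC j hj, ?_, ?_⟩
    · intro j hj
      have h := hw j
      simp only [f, hj, if_true] at h
      have h' : 4 * (iteratedDeriv 2 F (z j) / 2) * (π w (z j) + d₁ (z j)) < deriv c₁ (z j) ^ 2 := by linarith
      exact h'
    · intro j hj
      have h := hw j
      simp only [f, hj, show (3 : ℕ) ≠ 2 by norm_num, if_false, if_true] at h
      have h' : 3 * (iteratedDeriv 3 F (z j) / 6) * (deriv (π w) (z j) + deriv d₁ (z j)) < (iteratedDeriv 2 c₁ (z j) / 2) ^ 2 := by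
        linarith
      exact h'
  · obtain ⟨lam, hl0, hlne, hle⟩ :=
      (Literature.Analysis.Convex.ConvexInequalityAlternative.not_exists_forall_lt_iff hC hf).1 hfeas
    right
    refine ⟨lam, hl0, hlne, fun w hwC => ?_⟩
    exact hle w (fun j hj => hwC j hj)

end Summit.ValiantsHypothesis.ValiantsHypothesis.Theorems.LacunarySymmetroidMatrixDescartes.WallBubbling
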